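import Summits.KontsevichZagierPeriods.KontsevichZagierPeriods.Theorems.SoloInformedAlgToricFace
import Summits.KontsevichZagierPeriods.KontsevichZagierPeriods.Theorems.SoloInformedToricDominant
import HarnessLib

/-!
# LEMMA DOM over a field of real algebraic numbers

Solo programme `solo-KontsevichZagierPeriods-informed`, session s107: the re-base of the
DEN-calculus on a coefficient field `K` embedded in `ℝ`, step 9 — the criterion for
cube-nondegeneracy from dominant pure powers (`SoloInformedToricDominant`, LEMMA DOM) for
`K`-coefficients.  Since `K` carries no order, positivity of the pure-power coefficients `cᵢ` is
required of their real images `algebraMap K ℝ cᵢ`.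

* **LEMMA DOM over `K`** `soloInformed_cubeNondegenerateK_of_dominant`: let
  `Q = ∑ᵢ cᵢ xᵢ^{kᵢ} + R ∈ K[x]` with `kᵢ ≥ 1`, `cᵢ > 0` in `ℝ`, every monomial of `R` strictly
  divisible by some `xᵢ^{kᵢ}`, and `Q ≠ 0` on the punctured closed cube `[0,1]ⁿ ∖ {0}`.  Then `Q`
  is cube-nondegenerate (`SoloInformedCubeNondegenerateK`).
* Two-variable bookkeeping over `K` (`soloInformed_monomial_fin_twoK`,
  `soloInformed_sum_monomial_fin_twoK`) and the shape `x₀²·(quadratic in x₀) + x₁`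
  (`soloInformed_cubeNondegenerateK_sqQuadAddX`) met by both halves of the resolution of
  `(2x₀² − 1)² + x₁` in the next file.

References: A. G. Kouchnirenko, Invent. Math. 32 (1976) §1; M. Kontsevich, D. Zagier, *Periods*
(2001) §1.2.
-/

noncomputable section

open scoped BigOperators
open MeasureTheory Set
open Literature.NumberTheory.Transcendental Literature.NumberTheory.Transcendental.KZ

namespace Summit.KontsevichZagierPeriods.KontsevichZagierPeriods.Theorems

variable {n : ℕ} {K : Type*} [Field K] [Algebra K ℝ]

/-! ### LEMMA DOM over `K` -/

open Classical in
/-- **LEMMA DOM over `K` — cube-nondegeneracy from dominant pure powers.**  Let `n ≥ 1`,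
`Q = ∑ᵢ cᵢ xᵢ^{kᵢ} + R ∈ K[x₁, …, xₙ]` with all `kᵢ ≥ 1`, all `cᵢ > 0` (in `ℝ`), every exponent
of `R` strictly divisible by some `kᵢ eᵢ`, and `Q` without zero on the punctured closed cube
`[0,1]ⁿ ∖ {0}`.  Then `Q` is cube-nondegenerate. [this work; cf. Kouchnirenko 1976 §1] -/
theorem soloInformed_cubeNondegenerateK_of_dominant (hn : 0 < n) (k : Fin n → ℕ)
    (hk : ∀ i, 0 < k i) (c : Fin n → K) (hc : ∀ i, 0 < algebraMap K ℝ (c i))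
    (R : MvPolynomial (Fin n) K)
    (hR : ∀ a ∈ R.support, ∃ i, Finsupp.single i (k i) ≤ a ∧ Finsupp.single i (k i) ≠ a)
    (hpos : ∀ x : Fin n → ℝ, (∀ i, 0 ≤ x i ∧ x i ≤ 1) → x ≠ 0 →
      (MvPolynomial.aeval x
        ((∑ i, MvPolynomial.monomial (Finsupp.single i (k i)) (c i)) + R) : ℝ) ≠ 0) :
    SoloInformedCubeNondegenerateK
      ((∑ i, MvPolynomial.monomial (Finsupp.single i (k i)) (c i)) + R) := by
  set S : MvPolynomial (Fin n) K := ∑ i, MvPolynomial.monomial (Finsupp.single i (k i)) (c i)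
    with hS
  set Q : MvPolynomial (Fin n) K := S + R with hQ
  have hc0 : ∀ i, c i ≠ 0 := fun i h => (hc i).ne' (by rw [h, map_zero])
  -- coefficients of `S`
  have hinj : ∀ i j, Finsupp.single j (k j) = Finsupp.single i (k i) → j = i := by
    intro i j h
    by_contra hji
    have h' := Finsupp.ext_iff.1 h j
    rw [Finsupp.single_eq_same, Finsupp.single_eq_of_ne hji] at h'
    exact (hk j).ne' h'
  have hcoeffS : ∀ a, MvPolynomial.coeff a S =
      ∑ i, if Finsupp.single i (k i) = a then c i else 0 := by
    intro a
    rw [hS, MvPolynomial.coeff_sum]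
    exact Finset.sum_congr rfl fun i _ => MvPolynomial.coeff_monomial _ _ _
  have hcoeffS_single : ∀ i, MvPolynomial.coeff (Finsupp.single i (k i)) S = c i := by
    intro i
    rw [hcoeffS, Finset.sum_eq_single i (fun j _ hji => if_neg fun h => hji (hinj i j h))
      (fun h => (h (Finset.mem_univ i)).elim), if_pos rfl]
  have hcoeffS_zero : ∀ a, (∀ i, Finsupp.single i (k i) ≠ a) → MvPolynomial.coeff a S = 0 :=
    fun a ha => by rw [hcoeffS]; exact Finset.sum_eq_zero fun i _ => if_neg (ha i)
  -- `R` has no pure-power terms `kᵢ eᵢ`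
  have hRsingle : ∀ i, MvPolynomial.coeff (Finsupp.single i (k i)) R = 0 := by
    intro i
    by_contra h
    obtain ⟨j, hle, hne⟩ := hR _ (MvPolynomial.mem_support_iff.2 h)
    exact soloInformed_not_single_lt_single k hk i j hle hne
  have hQsingle : ∀ i, MvPolynomial.coeff (Finsupp.single i (k i)) Q = c i := fun i => by
    rw [hQ, MvPolynomial.coeff_add, hcoeffS_single, hRsingle, add_zero]
  have hsuppk : ∀ i, Finsupp.single i (k i) ∈ Q.support := fun i =>
    MvPolynomial.mem_support_iff.2 (by rw [hQsingle]; exact hc0 i)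
  -- the support of `Q`: pure powers or exponents of `R`
  have hsuppQ : ∀ a ∈ Q.support, (∃ i, a = Finsupp.single i (k i)) ∨ a ∈ R.support := by
    intro a ha
    by_cases haR : a ∈ R.support
    · exact Or.inr haR
    · left
      by_contra hnot
      push Not at hnot
      have h1 : MvPolynomial.coeff a S = 0 := hcoeffS_zero a fun i h => hnot i h.symm
      have h2 : MvPolynomial.coeff a R = 0 := MvPolynomial.notMem_support_iff.1 haR
      exact MvPolynomial.mem_support_iff.1 ha (by rw [hQ, MvPolynomial.coeff_add, h1, h2, add_zero])
  intro w y hy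
  rw [soloInformed_aeval_initFormK]
  by_cases hw : ∃ i, w i = 0
  · -- Case A: `w` has a zero entry — the initial form is `Q` on a coordinate face
    obtain ⟨i₀, hi₀⟩ := hw
    set z : Fin n → ℝ := fun i => if w i = 0 then y i else 0 with hz
    have hzcube : ∀ i, 0 ≤ z i ∧ z i ≤ 1 := by
      intro i
      by_cases h : w i = 0
      · simp only [hz, h, if_true]; exact ⟨(hy i).1.le, (hy i).2⟩
      · simp only [hz, h, if_false]; exact ⟨le_rfl, zero_le_one⟩
    have hz0 : z ≠ 0 := fun h => (hy i₀).1.ne' (by simpa [hz, hi₀] using congr_fun h i₀)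
    have hzQ := hpos z hzcube hz0
    -- `a` is initial iff `⟨w, a⟩ = 0`
    have hinit : ∀ a ∈ Q.support, (SoloInformedIsInitK w Q a ↔ soloInformedWDeg w a = 0) := by
      intro a _
      constructor
      · intro h
        have h1 := h _ (hsuppk i₀)
        rw [soloInformed_wdeg_single_mul, hi₀, zero_mul] at h1
        exact Nat.le_zero.1 h1
      · intro h b _
        rw [h]
        exact Nat.zero_le _
    -- `z^a = y^a` if `⟨w, a⟩ = 0`, else `0`
    have hza : ∀ a : Fin n →₀ ℕ, (∏ i, z i ^ a i) =
        if soloInformedWDeg w a = 0 then ∏ i, y i ^ a i else 0 := by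
      intro a
      split_ifs with h
      · rw [soloInformed_wdeg_eq_zero_iff] at h
        refine Finset.prod_congr rfl fun i _ => ?_
        rcases h i with hi | hi
        · simp only [hz, hi, if_true]
        · simp only [hi, pow_zero]
      · rw [soloInformed_wdeg_eq_zero_iff] at h
        push Not at h
        obtain ⟨i, hwi, hai⟩ := h
        exact Finset.prod_eq_zero (Finset.mem_univ i) (by simp [hz, hwi, hai])
    have hsum : (∑ a ∈ Q.support.filter (SoloInformedIsInitK w Q),
        algebraMap K ℝ (MvPolynomial.coeff a Q) * ∏ i, y i ^ a i) =
        MvPolynomial.aeval z Q := by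
      rw [soloInformed_aevalK_eq_sum_support, Finset.sum_filter]
      refine Finset.sum_congr rfl fun a ha => ?_
      rw [hza a]
      by_cases h : soloInformedWDeg w a = 0
      · rw [if_pos ((hinit a ha).2 h), if_pos h]
      · rw [if_neg (fun h' => h ((hinit a ha).1 h')), if_neg h, mul_zero]
    rw [hsum]
    exact hzQ
  · -- Case B: all entries of `w` positive — the initial exponents are pure powers `kᵢ eᵢ`
    push Not at hw
    have hw' : ∀ i, 0 < w i := fun i => Nat.pos_of_ne_zero (hw i)
    have hkey : ∀ a ∈ Q.support, SoloInformedIsInitK w Q a →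
        ∃ i, a = Finsupp.single i (k i) := by
      intro a ha hinit
      rcases hsuppQ a ha with h | haR
      · exact h
      · obtain ⟨i, hle, hne⟩ := hR a haR
        exact absurd (hinit _ (hsuppk i))
          (not_le.2 (soloInformed_wdeg_lt_of_le_of_ne w hw' hle hne))
    -- every initial term is positive on `(0,1]ⁿ` …
    have hterm : ∀ a ∈ Q.support.filter (SoloInformedIsInitK w Q),
        0 < algebraMap K ℝ (MvPolynomial.coeff a Q) * ∏ i, y i ^ a i := by
      intro a ha
      obtain ⟨ha, hinit⟩ := Finset.mem_filter.1 ha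
      obtain ⟨i, rfl⟩ := hkey a ha hinit
      refine mul_pos ?_ (Finset.prod_pos fun j _ => pow_pos (hy j).1 _)
      rw [hQsingle]
      exact hc i
    -- … and some exponent is initial
    have hne : Q.support.Nonempty := ⟨_, hsuppk ⟨0, hn⟩⟩
    obtain ⟨a₁, ha₁, hmin⟩ := Finset.exists_min_image Q.support (soloInformedWDeg w) hne
    have ha₁' : a₁ ∈ Q.support.filter (SoloInformedIsInitK w Q) :=
      Finset.mem_filter.2 ⟨ha₁, fun b hb => hmin b hb⟩
    exact (lt_of_lt_of_le (hterm _ ha₁')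
      (Finset.single_le_sum (fun a ha => (hterm a ha).le) ha₁')).ne'

/-! ### Two-variable bookkeeping over `K` -/

omit [Algebra K ℝ] in
/-- Two-variable monomials as products of powers. [folklore] -/
theorem soloInformed_monomial_fin_twoK (a b : ℕ) (c : K) :
    MvPolynomial.monomial (Finsupp.single (0 : Fin 2) a + Finsupp.single 1 b) c =
      MvPolynomial.C c * MvPolynomial.X 0 ^ a * MvPolynomial.X 1 ^ b := by
  rw [MvPolynomial.X_pow_eq_monomial, MvPolynomial.X_pow_eq_monomial,
    MvPolynomial.C_mul_monomial, MvPolynomial.monomial_mul, mul_one, mul_one]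

omit [Algebra K ℝ] in
/-- The pure-power part `c₀ x₀^{k₀} + c₁ x₁^{k₁}` in two variables. [folklore] -/
theorem soloInformed_sum_monomial_fin_twoK (k : Fin 2 → ℕ) (c : Fin 2 → K) :
    (∑ i : Fin 2, MvPolynomial.monomial (Finsupp.single i (k i)) (c i)) =
      MvPolynomial.C (c 0) * MvPolynomial.X 0 ^ k 0 + MvPolynomial.C (c 1) * MvPolynomial.X 1 ^ k 1 := by
  rw [Fin.sum_univ_two, MvPolynomial.X_pow_eq_monomial, MvPolynomial.X_pow_eq_monomial,
    MvPolynomial.C_mul_monomial, MvPolynomial.C_mul_monomial, mul_one, mul_one]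

/-! ### The shape `x₀² (p + q x₀ + r x₀²) + x₁` -/

/-- The polynomial `p x₀² + q x₀³ + r x₀⁴ + x₁ ∈ K[x₀, x₁]`. -/
def soloInformedSqQuadAddX (p q r : K) : MvPolynomial (Fin 2) K :=
  MvPolynomial.C p * MvPolynomial.X 0 ^ 2 + MvPolynomial.C q * MvPolynomial.X 0 ^ 3 +
    MvPolynomial.C r * MvPolynomial.X 0 ^ 4 + MvPolynomial.X 1

/-- Its higher-order part `R = q x₀³ + r x₀⁴`, every monomial strictly divisible by `x₀²`. -/
def soloInformedSqQuadR (q r : K) : MvPolynomial (Fin 2) K :=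
  MvPolynomial.monomial (Finsupp.single 0 3 + Finsupp.single 1 0) q +
    MvPolynomial.monomial (Finsupp.single 0 4 + Finsupp.single 1 0) r

omit [Algebra K ℝ] in
/-- `soloInformedSqQuadAddX` in the shape of LEMMA DOM (`k = (2, 1)`, `c = (p, 1)`). [this work] -/
theorem soloInformed_sqQuadAddX_eq (p q r : K) :
    (∑ i : Fin 2, MvPolynomial.monomial (Finsupp.single i (![2, 1] i)) (![p, 1] i)) +
        soloInformedSqQuadR q r = soloInformedSqQuadAddX p q r := by
  rw [soloInformed_sum_monomial_fin_twoK, soloInformedSqQuadR, soloInformedSqQuadAddX,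
    soloInformed_monomial_fin_twoK, soloInformed_monomial_fin_twoK]
  simp only [Matrix.cons_val_zero, Matrix.cons_val_one, map_one, pow_zero, mul_one, one_mul,
    pow_one]
  ring

/-- Evaluation of `soloInformedSqQuadAddX`. -/
theorem soloInformed_aeval_sqQuadAddX (p q r : K) (x : Fin 2 → ℝ) :
    (MvPolynomial.aeval x (soloInformedSqQuadAddX p q r) : ℝ) =
      algebraMap K ℝ p * x 0 ^ 2 + algebraMap K ℝ q * x 0 ^ 3 + algebraMap K ℝ r * x 0 ^ 4 +
        x 1 := by
  simp [soloInformedSqQuadAddX]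

omit [Algebra K ℝ] in
/-- `x₀²` strictly divides `x₀^a` for `a ≥ 3`. [folklore] -/
theorem soloInformed_single_zero_two_lt (a : ℕ) (ha : 2 < a) :
    Finsupp.single (0 : Fin 2) 2 ≤ Finsupp.single 0 a + Finsupp.single 1 0 ∧
      Finsupp.single (0 : Fin 2) 2 ≠ Finsupp.single 0 a + Finsupp.single 1 0 := by
  refine ⟨Finsupp.le_def.2 fun j => ?_, fun h => ?_⟩
  · fin_cases j
    · simpa using ha.le
    · simp
  · have h0 := Finsupp.ext_iff.1 h 0
    simp at h0
    omega

/-- **`p x₀² + q x₀³ + r x₀⁴ + x₁` is cube-nondegenerate** when `p > 0` in `ℝ` and the quadratic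
`p + q t + r t²` is positive on `[0,1]` (LEMMA DOM over `K` with `k = (2, 1)`: the monomials
`x₀³, x₀⁴` are strictly divisible by `x₀²`). [this work] -/
theorem soloInformed_cubeNondegenerateK_sqQuadAddX (p q r : K) (hp : 0 < algebraMap K ℝ p)
    (hquad : ∀ t : ℝ, 0 ≤ t → t ≤ 1 →
      0 < algebraMap K ℝ p + algebraMap K ℝ q * t + algebraMap K ℝ r * t ^ 2) :
    SoloInformedCubeNondegenerateK (soloInformedSqQuadAddX p q r) := by
  rw [← soloInformed_sqQuadAddX_eq]
  refine soloInformed_cubeNondegenerateK_of_dominant two_pos ![2, 1]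
    (fun i => by fin_cases i <;> simp) ![p, 1] (fun i => ?_)
    (soloInformedSqQuadR q r) (fun a ha => ⟨0, ?_⟩) fun x hx hx0 => ?_
  · fin_cases i
    · simpa using hp
    · simp
  · classical
    have hsub : (soloInformedSqQuadR q r).support ⊆
        {Finsupp.single 0 3 + Finsupp.single 1 0, Finsupp.single 0 4 + Finsupp.single 1 0} := by
      unfold soloInformedSqQuadR
      refine MvPolynomial.support_add.trans (Finset.union_subset ?_ ?_) <;>
        refine MvPolynomial.support_monomial_subset.trans ?_ <;> simp
    have ha' := hsub ha
    simp only [Finset.mem_insert, Finset.mem_singleton] at ha'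
    simp only [Matrix.cons_val_zero]
    rcases ha' with rfl | rfl
    · exact soloInformed_single_zero_two_lt 3 (by norm_num)
    · exact soloInformed_single_zero_two_lt 4 (by norm_num)
  · rw [soloInformed_sqQuadAddX_eq, soloInformed_aeval_sqQuadAddX]
    intro h
    have h0 : 0 ≤ x 0 := (hx 0).1
    have h1 : 0 ≤ x 1 := (hx 1).1
    have hq := hquad (x 0) h0 (hx 0).2
    have hsq : 0 ≤ x 0 ^ 2 := sq_nonneg _
    have hprod : x 0 ^ 2 * (algebraMap K ℝ p + algebraMap K ℝ q * x 0 +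
        algebraMap K ℝ r * x 0 ^ 2) + x 1 = 0 := by
      rw [← h]; ring
    have hx0sq : x 0 ^ 2 = 0 := by
      nlinarith [mul_nonneg hsq hq.le]
    have hx0' : x 0 = 0 := pow_eq_zero_iff (n := 2) (by norm_num) |>.1 hx0sq
    have hx1' : x 1 = 0 := by
      rw [hx0sq, zero_mul, zero_add] at hprod
      exact hprod
    exact hx0 (funext fun i => by fin_cases i <;> simp [hx0', hx1'])

end Summit.KontsevichZagierPeriods.KontsevichZagierPeriods.Theorems
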